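import Literature.NumberTheory.LFunctions.ClassGroupLogFreeLemmaA
import Literature.NumberTheory.LFunctions.LogFreeLemmaBAbstract
import Literature.NumberTheory.LFunctions.LogFreeDensityDirichletSide
import Literature.NumberTheory.LFunctions.DedekindZetaUniformBounds
import Mathlib.NumberTheory.LSeries.Injectivity
import HarnessLib

/-!
# Bombieri's Lemme B for the class group `L`-functions of a number field

Topic `Literature/NumberTheory/LFunctions`, namespace `Literature.NumberTheory.LFunctions.NumberField`.
Everything here is PROVED (one definition with body, theorems; no named facts).

For a number field `K` of degree `n_K`, a class group character `χ ≠ 1` and `w = 1 + iv`: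
`−L₀'/L₀(s, χ) = Σ_n Λ_χ(n) n^{−s}` (`Λ_χ = twistVonMangoldt`, `|Λ_χ(n)| ≤ Λ_K(n) ≤ n_K Λ(n)`, zero off
the prime powers), so that with the normalised coefficients `b_n = Λ_χ(n) n^{−1−iv}/n_K` (`coefB`,
`|b_n| ≤ Λ(n)/n`) the `k`-th derivative of `L₀'/L₀` at `s₀ = 1 + r + iv` is
`(−1)^{k+1} k! r^{−k} n_K Σ_n b_n p_k(r log n)`.  Lemme A for `L₀` (`lemmeA_classGroup₀`) thus gives the
hypothesis `hmain` of the abstract Lemme B (`LogFreeDensity.lemmeB_core_abstract`) with slack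
`η = n_K`, whence, for `n_K ≤ 4` (in particular for quadratic fields):

* `lemmeB_classGroup` — **Lemme B**: there are absolute `A₀, r₀ > 0` such that for `ℒ' = lemmaAHeight K v`,
  `0 < r ≤ r₀`, `rℒ' ≥ 1`, a zero of `L₀(·, χ)` within `r` of `1 + iv`, `log x ≥ A₀ ℒ'`, `z ≤ x^{a₀/2}`:
  `e^{−10}/n_K² · x^{−r/10}/r³ ≤ ∫_{⌊x^{a₀}⌋}^{x} ‖Σ_{⌊x^{a₀}⌋ < n ≤ t, n = p^m, p > z} b_n‖² dt/t`.

## References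

* [Bombieri1987GrandCrible] E. Bombieri, Astérisque 18 (1987), §6 Lemme B, pp. 46–48.
* [ThornerZaman2017] J. Thorner, A. Zaman, Algebra Number Theory 11 (2017), §5.
-/

noncomputable section

open Complex Metric Set Filter Finset
open scoped Real Topology LSeries.notation ArithmeticFunction.vonMangoldt

namespace Literature.NumberTheory.LFunctions.NumberField

open Literature.NumberTheory.LFunctions.LogFreeLocal Literature.NumberTheory.LFunctions.LogFreeDensity
open scoped nonZeroDivisors _root_.NumberField

variable {K : Type*} [Field K] [NumberField K]

/-! ### `Λ_K(n) ≤ n_K Λ(n)` and the normalised coefficients -/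

/-- The two von Mangoldt functions of the tree agree: `vonMangoldtNorm K n = vonMangoldtIdeal K n`
(`n ≥ 1`; both have the `L`-series `−ζ_K'/ζ_K`, `LSeries_vonMangoldtNorm_eq`, and `LSeries` is injective).
[folklore] -/
theorem vonMangoldtNorm_eq_vonMangoldtIdeal {n : ℕ} (hn : n ≠ 0) : vonMangoldtNorm K n = vonMangoldtIdeal K n := by
  have hf : LSeries.abscissaOfAbsConv (fun n ↦ (vonMangoldtNorm K n : ℂ)) < ⊤ := by
    exact lt_of_le_of_lt (LSeries.abscissaOfAbsConv_le_of_forall_lt_LSeriesSummable fun y hy ↦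
      LSeriesSummable_vonMangoldtNorm (K := K) (by simpa using hy)) (EReal.coe_lt_top 1)
  have hg : LSeries.abscissaOfAbsConv (fun n ↦ (vonMangoldtIdeal K n : ℂ)) < ⊤ := by
    exact lt_of_le_of_lt (LSeries.abscissaOfAbsConv_le_of_forall_lt_LSeriesSummable fun y hy ↦
      LSeriesSummable_vonMangoldtIdeal K (by simpa using hy)) (EReal.coe_lt_top 1)
  have hev : (fun x : ℝ ↦ LSeries (fun n ↦ (vonMangoldtNorm K n : ℂ)) x) =ᶠ[atTop]
      fun x : ℝ ↦ LSeries (fun n ↦ (vonMangoldtIdeal K n : ℂ)) x := by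
    filter_upwards [eventually_gt_atTop 1] with x hx
    exact LSeries_vonMangoldtNorm_eq (K := K) (by simpa using hx)
  have := LSeries.eq_of_LSeries_eventually_eq hf hg hev hn
  exact_mod_cast this

/-- **`Λ_K(n) ≤ n_K Λ(n)`** for the tree's `vonMangoldtNorm`. [folklore] -/
theorem vonMangoldtNorm_le_finrank_mul (n : ℕ) :
    vonMangoldtNorm K n ≤ Module.finrank ℚ K * Λ n := by
  rcases Nat.eq_zero_or_pos n with rfl | hn
  · have : vonMangoldtNorm K 0 = 0 := by
      have h := vonMangoldtNorm_le (K := K) 0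
      simp at h
      exact le_antisymm h (vonMangoldtNorm_nonneg 0)
    rw [this]; simp
  · rw [vonMangoldtNorm_eq_vonMangoldtIdeal hn.ne']
    exact vonMangoldtIdeal_le_finrank_mul_vonMangoldt K n

/-- `Λ_K(n) = 0` off the prime powers. [folklore] -/
theorem vonMangoldtNorm_eq_zero_of_not_isPrimePow {n : ℕ} (hn : ¬ IsPrimePow n) : vonMangoldtNorm K n = 0 := by
  have h := vonMangoldtNorm_le_finrank_mul (K := K) n
  rw [ArithmeticFunction.vonMangoldt_eq_zero_iff.2 hn, mul_zero] at h
  exact le_antisymm h (vonMangoldtNorm_nonneg n)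

/-- `|Λ_χ(n)| ≤ n_K Λ(n)` for a class group character. [folklore] -/
theorem norm_twistVonMangoldt_classGroup_le (χ : ClassGroup (𝓞 K) →* ℂˣ) (n : ℕ) :
    ‖twistVonMangoldt K (classGroupCharIdealHom χ) n‖ ≤ Module.finrank ℚ K * Λ n :=
  (norm_twistVonMangoldt_le (norm_classGroupCharIdealHom_le χ) n).trans (vonMangoldtNorm_le_finrank_mul n)

/-- `Λ_χ(n) = 0` off the prime powers. [folklore] -/
theorem twistVonMangoldt_classGroup_eq_zero (χ : ClassGroup (𝓞 K) →* ℂˣ) {n : ℕ} (hn : ¬ IsPrimePow n) :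
    twistVonMangoldt K (classGroupCharIdealHom χ) n = 0 := by
  have h := norm_twistVonMangoldt_le (norm_classGroupCharIdealHom_le χ) n
  rw [vonMangoldtNorm_eq_zero_of_not_isPrimePow hn] at h
  exact norm_le_zero_iff.mp h

variable (K) in
/-- The normalised coefficients `b_n = Λ_χ(n) n^{−1−iv}/n_K`. [cite: Bombieri1987GrandCrible, §6 Lemme B (proof)] -/
def coefB (χ : ClassGroup (𝓞 K) →* ℂˣ) (v : ℝ) (n : ℕ) : ℂ :=
  twistVonMangoldt K (classGroupCharIdealHom χ) n * (n : ℂ) ^ (-(1 + (v : ℂ) * I)) / (Module.finrank ℚ K : ℂ)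

/-- `‖b_n‖ ≤ Λ(n)/n`. [folklore] -/
theorem norm_coefB_le (χ : ClassGroup (𝓞 K) →* ℂˣ) (v : ℝ) (n : ℕ) : ‖coefB K χ v n‖ ≤ Λ n / n := by
  have hnK : (0 : ℝ) < Module.finrank ℚ K := by exact_mod_cast Module.finrank_pos (R := ℚ) (M := K)
  rcases Nat.eq_zero_or_pos n with rfl | hn
  · simp [coefB, twistVonMangoldt_zero]
  rw [coefB, norm_div, norm_mul, Complex.norm_natCast]
  have hcpow : ‖(n : ℂ) ^ (-(1 + (v : ℂ) * I))‖ = (n : ℝ)⁻¹ := by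
    rw [Complex.norm_natCast_cpow_of_pos hn]; simp [Real.rpow_neg_one]
  rw [hcpow, div_le_div_iff₀ hnK (by exact_mod_cast hn)]
  have h := norm_twistVonMangoldt_classGroup_le χ n
  have hn0 : (0 : ℝ) < n := by exact_mod_cast hn
  calc ‖twistVonMangoldt K (classGroupCharIdealHom χ) n‖ * (n : ℝ)⁻¹ * n
      = ‖twistVonMangoldt K (classGroupCharIdealHom χ) n‖ := by field_simp
    _ ≤ Module.finrank ℚ K * Λ n := h
    _ = Λ n * Module.finrank ℚ K := mul_comm _ _

/-- `b_n = 0` off the prime powers. [folklore] -/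
theorem coefB_eq_zero_of_not_isPrimePow (χ : ClassGroup (𝓞 K) →* ℂˣ) (v : ℝ) {n : ℕ} (hn : ¬ IsPrimePow n) :
    coefB K χ v n = 0 := by
  simp [coefB, twistVonMangoldt_classGroup_eq_zero χ hn]

/-! ### `(L₀'/L₀)^{(k)}` as a Dirichlet series -/

/-- For `Re s > 1`: `L₀'/L₀(·, χ)` agrees near `s` with `−L(Λ_χ, ·)`. [folklore] -/
theorem logDeriv_classGroupLFunction₀_eventuallyEq {χ : ClassGroup (𝓞 K) →* ℂˣ} (hχ : χ ≠ 1) {s : ℂ}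
    (hs : 1 < s.re) :
    logDeriv (classGroupLFunction₀ K χ) =ᶠ[𝓝 s] fun z => -LSeries (twistVonMangoldt K (classGroupCharIdealHom χ)) z := by
  have hopen : IsOpen {z : ℂ | 1 < z.re} := isOpen_lt continuous_const Complex.continuous_re
  filter_upwards [hopen.mem_nhds hs] with z hz
  rw [logDeriv_apply, logDeriv_classGroupLFunction₀_eq hχ hz]

/-- The abscissa of absolute convergence of `Λ_χ` is `≤ 1`. [folklore] -/
theorem abscissaOfAbsConv_twistVonMangoldt_classGroup_le (χ : ClassGroup (𝓞 K) →* ℂˣ) :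
    LSeries.abscissaOfAbsConv (twistVonMangoldt K (classGroupCharIdealHom χ)) ≤ 1 :=
  LSeries.abscissaOfAbsConv_le_of_forall_lt_LSeriesSummable fun y hy =>
    LSeriesSummable_twistVonMangoldt (norm_classGroupCharIdealHom_le χ) (by simpa using hy)

/-- **`(L₀'/L₀)^{(k)}(s, χ) = (−1)^{k+1} L(log^k · Λ_χ, s)`** for `Re s > 1`.
[cite: Bombieri1987GrandCrible, §6 Lemme B (proof)] -/
theorem iteratedDeriv_logDeriv_classGroupLFunction₀_eq {χ : ClassGroup (𝓞 K) →* ℂˣ} (hχ : χ ≠ 1) {s : ℂ}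
    (hs : 1 < s.re) (k : ℕ) :
    iteratedDeriv k (logDeriv (classGroupLFunction₀ K χ)) s =
      (-1) ^ (k + 1) * LSeries (LSeries.logMul^[k] (twistVonMangoldt K (classGroupCharIdealHom χ))) s := by
  rw [(logDeriv_classGroupLFunction₀_eventuallyEq hχ hs).iteratedDeriv_eq, iteratedDeriv_fun_neg,
    LSeries_iteratedDeriv k (lt_of_le_of_lt (abscissaOfAbsConv_twistVonMangoldt_classGroup_le χ) (by exact_mod_cast hs))]
  ring

/-- **The terms in terms of `p_k`**: for `s₀ = 1 + r + iv`, `r > 0`,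
`(log n)^k Λ_χ(n) n^{−s₀} = k! r^{−k} n_K · b_n p_k(r log n)`. [cite: Bombieri1987GrandCrible, §6 Lemme B (proof)] -/
theorem term_logMul_eq_coefB (χ : ClassGroup (𝓞 K) →* ℂˣ) (v : ℝ) {r : ℝ} (hr : 0 < r) (k n : ℕ) :
    LSeries.term (LSeries.logMul^[k] (twistVonMangoldt K (classGroupCharIdealHom χ))) (((1 + r : ℝ) : ℂ) + (v : ℂ) * I) n =
      (k.factorial : ℂ) * (r⁻¹ : ℂ) ^ k * (Module.finrank ℚ K : ℂ) * gTermB (coefB K χ v) r k n := by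
  rcases Nat.eq_zero_or_pos n with rfl | hn
  · rw [LSeries.term_zero, gTermB, coefB]
    simp [twistVonMangoldt_zero]
  have hn0 : (0 : ℝ) < n := by exact_mod_cast hn
  have hnC : (n : ℂ) ≠ 0 := by exact_mod_cast hn.ne'
  have hnK : (Module.finrank ℚ K : ℂ) ≠ 0 := by exact_mod_cast (Module.finrank_pos (R := ℚ) (M := K)).ne'
  have hfun : LSeries.logMul^[k] (twistVonMangoldt K (classGroupCharIdealHom χ)) =
      fun m : ℕ ↦ (Real.log m : ℂ) ^ k * twistVonMangoldt K (classGroupCharIdealHom χ) m :=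
    funext fun m ↦ logMul_iterate_apply _ k m
  rw [hfun, LSeries.term_of_ne_zero hn.ne', gTermB, coefB]
  set a : ℂ := twistVonMangoldt K (classGroupCharIdealHom χ) n with ha
  have hcancel : (k.factorial : ℂ) * (r⁻¹ : ℂ) ^ k * (Module.finrank ℚ K : ℂ) *
      (a * (n : ℂ) ^ (-(1 + (v : ℂ) * I)) / (Module.finrank ℚ K : ℂ) * (pk k (r * Real.log n) : ℂ)) =
      (k.factorial : ℂ) * (r⁻¹ : ℂ) ^ k * (a * (n : ℂ) ^ (-(1 + (v : ℂ) * I))) * (pk k (r * Real.log n) : ℂ) := by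
    field_simp
  rw [hcancel]
  -- split `n^{-s₀} = n^{-(1+iv)} · n^{-r}` with `n^{-r}` real
  have hsplit : (n : ℂ) ^ (((1 + r : ℝ) : ℂ) + (v : ℂ) * I) =
      (n : ℂ) ^ ((1 : ℂ) + (v : ℂ) * I) * (((n : ℝ) ^ r : ℝ) : ℂ) := by
    rw [show (((1 + r : ℝ) : ℂ) + (v : ℂ) * I) = ((1 : ℂ) + (v : ℂ) * I) + (r : ℂ) by push_cast; ring,
      Complex.cpow_add _ _ hnC, Complex.ofReal_cpow hn0.le]
    norm_cast
  have hreal := pow_log_mul_rpow_neg_eq hr k hn0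
  have hfac : (k.factorial : ℝ) ≠ 0 := by positivity
  have hreal' : Real.log n ^ k * (n : ℝ) ^ (-r) = (k.factorial : ℝ) * (r⁻¹ ^ k * pk k (r * Real.log n)) := by
    rw [← hreal]; field_simp
  have hrpow : ((n : ℝ) ^ r : ℝ) ≠ 0 := (Real.rpow_pos_of_pos hn0 r).ne'
  have hneg : (((n : ℝ) ^ (-r) : ℝ) : ℂ) = ((((n : ℝ) ^ r : ℝ) : ℂ))⁻¹ := by
    rw [Real.rpow_neg hn0.le]; push_cast; rfl
  have hcpow1 : (n : ℂ) ^ ((1 : ℂ) + (v : ℂ) * I) ≠ 0 := by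
    rw [Ne, Complex.cpow_eq_zero_iff]; exact fun h => hnC h.1
  rw [hsplit, show (-(1 + (v : ℂ) * I)) = -((1 : ℂ) + (v : ℂ) * I) by ring, Complex.cpow_neg]
  have hcast := congr_arg (fun x : ℝ => (x : ℂ)) hreal'
  simp only [Complex.ofReal_mul, Complex.ofReal_pow, Complex.ofReal_natCast, Complex.ofReal_inv] at hcast
  rw [hneg] at hcast
  field_simp
  linear_combination a * hcast

/-- The weighted series is summable (`r > 0`). [folklore] -/
theorem summable_gTermB_coefB (χ : ClassGroup (𝓞 K) →* ℂˣ) (v : ℝ) {r : ℝ} (hr : 0 < r) (k : ℕ) :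
    Summable (gTermB (coefB K χ v) r k) := by
  have habs : LSeries.abscissaOfAbsConv (LSeries.logMul^[k] (twistVonMangoldt K (classGroupCharIdealHom χ))) ≤ 1 := by
    induction k with
    | zero => exact abscissaOfAbsConv_twistVonMangoldt_classGroup_le χ
    | succ k ih => rw [Function.iterate_succ', Function.comp, LSeries.abscissaOfAbsConv_logMul]; exact ih
  have hsum : LSeriesSummable (LSeries.logMul^[k] (twistVonMangoldt K (classGroupCharIdealHom χ)))
      (((1 + r : ℝ) : ℂ) + (v : ℂ) * I) := by
    refine LSeriesSummable_of_abscissaOfAbsConv_lt_re (lt_of_le_of_lt habs ?_)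
    have : (((1 + r : ℝ) : ℂ) + (v : ℂ) * I).re = 1 + r := by simp
    rw [this]; exact_mod_cast (show (1:ℝ) < 1 + r by linarith)
  have hnK : (Module.finrank ℚ K : ℂ) ≠ 0 := by exact_mod_cast (Module.finrank_pos (R := ℚ) (M := K)).ne'
  have h := hsum.mul_left ((r : ℂ) ^ k / (k.factorial * (Module.finrank ℚ K : ℂ)))
  refine h.congr fun n => ?_
  rw [term_logMul_eq_coefB χ v hr k n, inv_pow]
  have hfac : (k.factorial : ℂ) ≠ 0 := by exact_mod_cast k.factorial_ne_zero
  have hrC : (r : ℂ) ^ k ≠ 0 := pow_ne_zero _ (by exact_mod_cast hr.ne')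
  field_simp

/-- **The norm of `(L₀'/L₀)^{(k)}(s₀, χ)`**: `‖(L₀'/L₀)^{(k)}(s₀)‖ = k! r^{−k} n_K ‖Σ_n b_n p_k(r log n)‖`.
[folklore] -/
theorem norm_iteratedDeriv_logDeriv_classGroupLFunction₀_eq {χ : ClassGroup (𝓞 K) →* ℂˣ} (hχ : χ ≠ 1)
    (v : ℝ) {r : ℝ} (hr : 0 < r) (k : ℕ) :
    ‖iteratedDeriv k (logDeriv (classGroupLFunction₀ K χ)) (((1 + r : ℝ) : ℂ) + (v : ℂ) * I)‖ =
      k.factorial * r⁻¹ ^ k * Module.finrank ℚ K * ‖∑' n, gTermB (coefB K χ v) r k n‖ := by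
  have hs₀re : 1 < (((1 + r : ℝ) : ℂ) + (v : ℂ) * I).re := by simp; linarith
  rw [iteratedDeriv_logDeriv_classGroupLFunction₀_eq hχ hs₀re k, norm_mul, norm_pow, norm_neg, norm_one, one_pow,
    one_mul, LSeries]
  have htsum : ∑' n, LSeries.term (LSeries.logMul^[k] (twistVonMangoldt K (classGroupCharIdealHom χ)))
      (((1 + r : ℝ) : ℂ) + (v : ℂ) * I) n =
      (k.factorial : ℂ) * (r⁻¹ : ℂ) ^ k * (Module.finrank ℚ K : ℂ) * ∑' n, gTermB (coefB K χ v) r k n := by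
    rw [← tsum_mul_left]
    exact tsum_congr fun n => term_logMul_eq_coefB χ v hr k n
  rw [htsum, norm_mul, norm_mul, norm_mul, Complex.norm_natCast, norm_pow, norm_inv, Complex.norm_real,
    Real.norm_eq_abs, abs_of_pos hr, Complex.norm_natCast]

/-! ### Lemme A on the series side and Lemme B -/

/-- **Lemme A on the series side** for `L₀(s, χ)`: with the constant `c₄` of `lemmeA_classGroup₀`,
for `K' ≥ c₄ rℒ' + 2` there is `k ∈ [K', 2K']` with
`e^{−10K'} 2^{−(k+1)}/r ≤ n_K ‖Σ_n b_n p_k(r log n)‖`. [cite: Bombieri1987GrandCrible, §6 Lemme B (proof)] -/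
theorem exists_norm_tsum_gTermB_ge_classGroup :
    ∃ c₄ : ℝ, 0 < c₄ ∧ ∀ (K : Type*) [Field K] [NumberField K] (χ : ClassGroup (𝓞 K) →* ℂˣ), χ ≠ 1 →
      (∀ ρ : ℂ, classGroupLFunction₀ K χ ρ = 0 → ρ.re < 1) →
      ∀ (v r L' : ℝ), lemmaAHeight K v ≤ L' → 0 < r → 512 * r ≤ 1 / 8 → 1 ≤ r * L' →
        (∃ ρ₀ : ℂ, classGroupLFunction₀ K χ ρ₀ = 0 ∧ ‖ρ₀ - (1 + (v : ℂ) * I)‖ ≤ r) →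
        ∀ K' : ℕ, c₄ * (r * L') + 2 ≤ K' →
          ∃ k ∈ Finset.Icc K' (2 * K'),
            Real.exp (-(10 * K')) * (2⁻¹ ^ (k + 1) / r) ≤
              Module.finrank ℚ K * ‖∑' n, gTermB (coefB K χ v) r k n‖ := by
  obtain ⟨c₄, h₄, hA⟩ := lemmeA_classGroup₀
  refine ⟨c₄, h₄, fun K _ _ χ hχ hline v r L' hL hr hr8 hu hzero K' hK' => ?_⟩
  obtain ⟨k, hk, hbound⟩ := hA K χ hχ hline v r L' hL hr hr8 hu hzero K' hK'
  refine ⟨k, hk, ?_⟩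
  rw [norm_iteratedDeriv_logDeriv_classGroupLFunction₀_eq hχ v hr k] at hbound
  have hfacpos : (0 : ℝ) < k.factorial := by positivity
  have hsimp : (k.factorial : ℝ) * r⁻¹ ^ k * Module.finrank ℚ K * ‖∑' n, gTermB (coefB K χ v) r k n‖ / k.factorial =
      r⁻¹ ^ k * (Module.finrank ℚ K * ‖∑' n, gTermB (coefB K χ v) r k n‖) := by field_simp
  rw [hsimp] at hbound
  have key : Real.exp (-(10 * K')) * (2⁻¹ ^ (k + 1) / r) =
      r ^ k * (Real.exp (-(10 * K')) * (2 * r)⁻¹ ^ (k + 1)) := by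
    rw [mul_inv, mul_pow, pow_succ r⁻¹ k, inv_pow, inv_pow]
    field_simp
  rw [key]
  calc r ^ k * (Real.exp (-(10 * K')) * (2 * r)⁻¹ ^ (k + 1))
      ≤ r ^ k * (r⁻¹ ^ k * (Module.finrank ℚ K * ‖∑' n, gTermB (coefB K χ v) r k n‖)) :=
        mul_le_mul_of_nonneg_left hbound (by positivity)
    _ = Module.finrank ℚ K * ‖∑' n, gTermB (coefB K χ v) r k n‖ := by
        rw [← mul_assoc, ← mul_pow, mul_inv_cancel₀ hr.ne', one_pow, one_mul]

/-- **Bombieri's Lemme B for `L₀(s, χ)`, `χ ≠ 1`, degree `n_K ≤ 4`** (uniformly in the field):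
there are absolute `A₀, r₀ > 0` such that for `ℒ' = lemmaAHeight K v`, `0 < r ≤ r₀`, `rℒ' ≥ 1`,
`L₀ ≠ 0` on `Re s ≥ 1`, a zero `ρ₀` of `L₀(·, χ)` with `|ρ₀ − (1 + iv)| ≤ r`, `0 < x`,
`log x ≥ A₀ ℒ'` and `z ≤ x^{a₀/2}`,
`e^{−10}/n_K² · x^{−r/10}/r³ ≤ ∫_{⌊x^{a₀}⌋}^{x} ‖Σ_{⌊x^{a₀}⌋ < n ≤ t, n = p^m, p > z} b_n‖² dt/t`.
[cite: Bombieri1987GrandCrible, §6 Lemme B] -/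
theorem lemmeB_classGroup :
    ∃ A₀ r₀ : ℝ, 0 < A₀ ∧ 0 < r₀ ∧
      ∀ (K : Type*) [Field K] [NumberField K] (χ : ClassGroup (𝓞 K) →* ℂˣ), χ ≠ 1 →
      Module.finrank ℚ K ≤ 4 →
      (∀ ρ : ℂ, classGroupLFunction₀ K χ ρ = 0 → ρ.re < 1) →
      ∀ (v r L' x : ℝ) (z : ℕ), lemmaAHeight K v ≤ L' → 0 < r → r ≤ r₀ → 1 ≤ r * L' →
        (∃ ρ₀ : ℂ, classGroupLFunction₀ K χ ρ₀ = 0 ∧ ‖ρ₀ - (1 + (v : ℂ) * I)‖ ≤ r) →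
        0 < x → A₀ * L' ≤ Real.log x → (z : ℝ) ≤ x ^ (expoB / 2) →
          Real.exp (-10) / (Module.finrank ℚ K : ℝ) ^ 2 * x ^ (-(r / 10)) / r ^ 3 ≤
            ∫ t in Set.Ioc (⌊x ^ expoB⌋₊ : ℝ) x, ‖summatory (coefSiftedB (coefB K χ v) x z) t‖ ^ 2 / t := by
  obtain ⟨c₄, hc₄, hA⟩ := exists_norm_tsum_gTermB_ge_classGroup
  set θ : ℝ := Real.exp 14 with hθ
  have hθ1 : 1 ≤ θ := Real.one_le_exp (by norm_num)
  refine ⟨240 * (c₄ + 8 * θ + 8), 1 / (112 * θ), by positivity, by positivity,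
    fun K _ _ χ hχ hnK hline v r L' x z hL hr hr0 hu hzero hx hlogx hz => ?_⟩
  have hL'1 : 1 ≤ L' := (one_le_lemmaAHeight v).trans hL
  set u : ℝ := r * L' with hudef
  have hr1 : r ≤ 1 := by
    have : 1 / (112 * θ) ≤ 1 := by rw [div_le_one (by positivity)]; nlinarith
    linarith
  have hr8 : 512 * r ≤ 1 / 8 := by
    have h := hr0
    rw [le_div_iff₀ (by positivity)] at h
    have h14 : (4096 : ℝ) ≤ θ := by
      have := pow_le_exp_mul (c := 4096) (m := 14) (by norm_num) (by norm_num) 1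
      simpa [hθ] using this
    nlinarith
  set Lx : ℝ := Real.log x with hLx
  have hA₀pos : 0 < 240 * (c₄ + 8 * θ + 8) := by positivity
  have hLxpos : 0 < Lx := lt_of_lt_of_le (by positivity) hlogx
  have hrLx : 240 * (c₄ + 8 * θ + 8) * u ≤ r * Lx := by
    rw [hudef]
    have := mul_le_mul_of_nonneg_left hlogx hr.le
    linarith
  set K' : ℕ := ⌊r * Lx / 240⌋₊ with hKdef
  have hK1 : (K' : ℝ) ≤ r * Lx / 240 := Nat.floor_le (by positivity)
  have hKlow : (c₄ + 8 * θ + 8) * u - 1 ≤ K' := by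
    have hK2 : r * Lx / 240 < K' + 1 := Nat.lt_floor_add_one _
    have : (c₄ + 8 * θ + 8) * u ≤ r * Lx / 240 := by
      rw [le_div_iff₀ (by norm_num)]; linarith
    linarith
  have hu1 : (1 : ℝ) ≤ u := hu
  have hprod1 : 0 ≤ (8 * θ + 8) * (u - 1) := mul_nonneg (by positivity) (by linarith only [hu1])
  have hprod2 : 0 ≤ c₄ * u := mul_nonneg hc₄.le (by linarith only [hu1])
  have hKc : c₄ * (r * L') + 2 ≤ K' := by
    rw [← hudef]
    nlinarith only [hKlow, hprod1, hθ1, hu1]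
  have hK8r : (8 : ℝ) ≤ K' := by
    nlinarith only [hKlow, hprod1, hprod2, hθ1, hu1]
  have hK8 : 8 ≤ K' := by exact_mod_cast hK8r
  have hKθ : 8 * θ * u ≤ K' := by
    nlinarith only [hKlow, hprod2, hu1]
  -- Lemme A on the series side, slack `η = n_K`
  obtain ⟨k, hk, hmain⟩ := hA K χ hχ hline v r L' hL hr hr8 hu hzero K' hKc
  have hη1 : (1 : ℝ) ≤ Module.finrank ℚ K := by exact_mod_cast Module.finrank_pos (R := ℚ) (M := K)
  have hη4 : (Module.finrank ℚ K : ℝ) ≤ 4 := by exact_mod_cast hnK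
  have h := lemmeB_core_abstract (norm_coefB_le χ v) (fun n hn ↦ coefB_eq_zero_of_not_isPrimePow χ v hn)
    hr hr0 hu hx hη1 hη4 hK8 hKθ hk (summable_gTermB_coefB χ v hr k) hmain hz
  exact h

end Literature.NumberTheory.LFunctions.NumberField

end
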